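import Summits.ABC.ABC.Theorems.TwistAmplificationMazurKaneLawRecordDefs
import Summits.ABC.ABC.Theorems.TwistAmplificationMazurKaneLawDetTool
import Summits.ABC.ABC.Theorems.TwistAmplificationMazurKaneLawSqrtLatticeToolZ
import Literature.NumberTheory.Sieve.DivisorBound

-- Summit.ABC.ABC is the mandated summit-side namespace (single-conjunct summit); the lakefile sets the same option tree-wide.
set_option linter.dupNamespace false

/-!
# The generic endgame of a certified record exponent (crux stmt-ABC-2757, stub `shapeCount_le_of_recordInstance`)

Line `fibre-toolkit-lp-wall-map` of the crux `Summit.ABC.ABC.Theses.TwistAmplification.MazurKaneLaw`, record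
pipeline step 3 (ENDGAME): a record instance `Toolkit.RecordInstance J s₀ Vc` (the linear-programme certificate
read through the exponent dictionary: `log_Λ B ≤ Vc + σ` whenever the slack `σ = recordSlack J (J+e) Λ Dτ P₀ t s₀`
is `≤ 1/1000`) gives the multiplicative bound `B_M ≤ K · C₀^{Vc+η}` on every datum admissible for `(l, ε)`
with `l + 3ε ≤ s₀`, in every dimension `M = J + e`, for every `η > 0`.

Proof (`shapeCount_le_of_recordInstance`). The tools are the landed `detTool`, `sqrtLatticeToolX`,
`sqrtLatticeToolZ`; the constants are those of `toolkitTame`: `Λ = 2C₀`, `T = V₂ Λ`, `Dτ = ⌊C_τ T^κ⌋`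
(divisor bound), `P₀ = max(1, N₀, 2 log((M+2)T³)) ≤ P_c Λ^{ρ/2}` (`log x ≤ x^{κ₂}/κ₂`). With
`ρ = min(1/2000, η/2)`, `aκ = ρ/2` (`a = 12M + 3J + 10`) and `3κ₂ = ρ/2` the slack satisfies
`σ ≤ L / log Λ + ρ` for ONE constant `L` (the sum of the logarithms of the constants), because
`log_Λ Dτ ≤ log_Λ C_τ + κ (log_Λ V₂ + 1)`, `log_Λ P₀ ≤ log_Λ P_c + ρ/2` and `(t − s₀)₊ = 0`.
LARGE SCALE (`L / log Λ ≤ ρ`): `σ ≤ 2ρ ≤ min(1/1000, η)`, so `log_Λ B ≤ Vc + η` and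
`B ≤ Λ^{Vc+η} = 2^{Vc+η} C₀^{Vc+η}`. SMALL SCALE (`Λ < Λ₁ = exp(L/ρ)`): the trivial box bound
`B ≤ ∏ XᵢYᵢZᵢ ≤ Λ^{t} ≤ Λ₁^{t₊}`. Hence `K = 2^{Vc+η} + Λ₁^{t₊}`.
-/

noncomputable section

open Finset
open Literature.NumberTheory.DiophantineGeometry
open Literature.NumberTheory.DiophantineGeometry.AbcShapes

namespace Summit.ABC.ABC.Theorems.MazurKaneLaw

open Summit.ABC.ABC.Theorems.MazurKaneLaw.Toolkit

/-- The trivial box bound `B_d ≤ ∏ᵢ XᵢYᵢZᵢ`: the counted triples lie in the product of the three dyadic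
boxes, of `∏ Xᵢ · ∏ Yᵢ · ∏ Zᵢ` elements (`card_dyadicBox`). [folklore] -/
theorem shapeCount_le_prod_box {d : ℕ} (c₁ c₂ c₃ : ℕ) (X Y Z : Fin d → ℕ) :
    (shapeCount c₁ c₂ c₃ X Y Z : ℝ) ≤ ∏ i, ((X i : ℝ) * Y i * Z i) := by
  classical
  have h : shapeCount c₁ c₂ c₃ X Y Z ≤ (dyadicBox X ×ˢ dyadicBox Y ×ˢ dyadicBox Z).card := by
    rw [shapeCount, shapeTriples]
    exact card_filter_le _ _
  rw [card_product, card_product, card_dyadicBox, card_dyadicBox, card_dyadicBox] at h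
  calc (shapeCount c₁ c₂ c₃ X Y Z : ℝ) ≤ ((∏ i, X i) * ((∏ i, Y i) * ∏ i, Z i) : ℕ) := by
        exact_mod_cast h
    _ = ∏ i, ((X i : ℝ) * Y i * Z i) := by
        push_cast
        rw [prod_mul_distrib, prod_mul_distrib]
        ring

/-- **The generic endgame of the certified record exponents.** If `RecordInstance J s₀ Vc` holds, then for
every `e`, every `(l, ε)` with `ε > 0`, `l + 3ε ≤ s₀`, and every `η > 0` there is `K ≥ 0` such that
`B_{J+e}(c; X, Y, Z) ≤ K · C₀^{Vc+η}` for all data `(C₀; c; X, Y, Z)` admissible for `(l, ε)`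
(`AbcShapes.Admissible`). Constants: `Λ = 2C₀`, `T = V₂Λ`, `Dτ = ⌊C_τ T^κ⌋`, `P₀ = max(1, N₀, 2 log((M+2)T³))`,
`ρ = min(1/2000, η/2)`, `aκ = 3κ₂ = ρ/2`; the slack is `≤ L/log Λ + ρ`, and one splits at `L/log Λ ≤ ρ`
(record instance, `B ≤ Λ^{Vc+η}`) versus `Λ < exp(L/ρ)` (trivial box bound). [folklore] -/
theorem shapeCount_le_of_recordInstance : ∀ (J : ℕ) (s₀ Vc : ℝ), 1 ≤ J → 0 ≤ Vc → Summit.ABC.ABC.Theorems.MazurKaneLaw.Toolkit.RecordInstance J s₀ Vc → ∀ (e : ℕ) (l ε : ℝ), 0 < ε → l + 3 * ε ≤ s₀ → ∀ η : ℝ, 0 < η → ∃ K : ℝ, 0 ≤ K ∧ ∀ (C₀ c₁ c₂ c₃ : ℕ) (X Y Z : Fin (J + e) → ℕ), Literature.NumberTheory.DiophantineGeometry.AbcShapes.Admissible l ε C₀ c₁ c₂ c₃ X Y Z → (Literature.NumberTheory.DiophantineGeometry.AbcShapes.shapeCount c₁ c₂ c₃ X Y Z : ℝ) ≤ K * (C₀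 : ℝ) ^ (Vc + η) := by
  intro J s₀ Vc _hJ hVc hR e l ε _hε hl η hη
  classical
  obtain ⟨N₀, hN₀, hdet⟩ := detTool
  -- the constants `V₂`, `a = 12M + 3J + 10`, `ρ`, `κ = ρ/(2a)`, `C_τ`, `κ₂ = ρ/6`, `P_c`, `L`, `Λ₁`, `K`
  obtain ⟨V2, hV2⟩ : ∃ V : ℕ, V = shapeVal (fun _ : Fin (J + e) => 2) := ⟨_, rfl⟩
  have hV2pos : 0 < V2 := by rw [hV2]; exact shapeVal_pos fun _ => two_pos
  have hV2r : (0 : ℝ) < V2 := by exact_mod_cast hV2pos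
  obtain ⟨a, ha⟩ : ∃ a : ℝ, a = 12 * ((J + e : ℕ) : ℝ) + 3 * J + 10 := ⟨_, rfl⟩
  have ha0 : 0 < a := by rw [ha]; positivity
  obtain ⟨ρ, hρ⟩ : ∃ ρ : ℝ, ρ = min (1 / 2000) (η / 2) := ⟨_, rfl⟩
  have hρ0 : 0 < ρ := by rw [hρ]; exact lt_min (by norm_num) (by positivity)
  have hρ1 : ρ ≤ 1 / 2000 := by rw [hρ]; exact min_le_left _ _
  have hρη : ρ ≤ η / 2 := by rw [hρ]; exact min_le_right _ _
  obtain ⟨κ, hκ⟩ : ∃ κ : ℝ, κ = ρ / 2 / a := ⟨_, rfl⟩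
  have hκ0 : 0 < κ := by rw [hκ]; positivity
  have hκa : a * κ = ρ / 2 := by rw [hκ]; field_simp
  obtain ⟨Cτ, hCτ1, hCτ⟩ := Literature.NumberTheory.Sieve.exists_card_divisors_le_mul_rpow hκ0
  have hCτ0 : 0 < Cτ := by linarith
  obtain ⟨κ₂, hκ₂⟩ : ∃ κ₂ : ℝ, κ₂ = ρ / 6 := ⟨_, rfl⟩
  have hκ₂0 : 0 < κ₂ := by rw [hκ₂]; positivity
  obtain ⟨G, hG⟩ : ∃ G : ℝ, G = (((J + e : ℕ) : ℝ) + 2) * (V2 : ℝ) ^ 3 := ⟨_, rfl⟩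
  have hG0 : 0 < G := by rw [hG]; positivity
  obtain ⟨Pc, hPc⟩ : ∃ Pc : ℝ, Pc = 1 + N₀ + 2 * (G ^ κ₂ / κ₂) := ⟨_, rfl⟩
  have hPc1 : 1 + N₀ ≤ Pc := by rw [hPc]; linarith [show 0 ≤ 2 * (G ^ κ₂ / κ₂) by positivity]
  have hPc0 : 0 < Pc := by linarith
  obtain ⟨L, hL⟩ : ∃ L : ℝ, L = a * Real.log Cτ + (ρ / 2 + 1) * Real.log V2 +
      ((J : ℝ) ^ 2 + J + 10) * Real.log 2 + Real.log 27 + Real.log 48 + Real.log 114 +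
      Real.log (24 * (J : ℝ) * ((J : ℝ) + 1)) + Real.log Pc := ⟨_, rfl⟩
  obtain ⟨Λ₁, hΛ₁⟩ : ∃ Λ₁ : ℝ, Λ₁ = Real.exp (L / ρ) := ⟨_, rfl⟩
  have hΛ₁0 : 0 < Λ₁ := by rw [hΛ₁]; exact Real.exp_pos _
  obtain ⟨K, hK⟩ : ∃ K : ℝ, K = (2 : ℝ) ^ (Vc + η) + Λ₁ ^ (max (l + 3 * ε) 0) := ⟨_, rfl⟩
  have hK2 : (2 : ℝ) ^ (Vc + η) ≤ K := by
    rw [hK]; exact le_add_of_nonneg_right (Real.rpow_nonneg hΛ₁0.le _)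
  have hKΛ : Λ₁ ^ (max (l + 3 * ε) 0) ≤ K := by
    rw [hK]; exact le_add_of_nonneg_left (Real.rpow_nonneg zero_le_two _)
  have hK0 : 0 ≤ K := (Real.rpow_nonneg hΛ₁0.le _).trans hKΛ
  refine ⟨K, hK0, fun C₀ c₁ c₂ c₃ X Y Z hA => ?_⟩
  obtain ⟨hC₀1, hc₁, hc₂, hc₃, -, -, -, hXp, hYp, hZp, hPle, hvX, hvY, hvZ, hC₀le⟩ := hA
  have hC₀ : (1 : ℝ) ≤ C₀ := by exact_mod_cast hC₀1
  have hCpow : 1 ≤ (C₀ : ℝ) ^ (Vc + η) := Real.one_le_rpow hC₀ (by linarith)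
  rcases Nat.eq_zero_or_pos (shapeCount c₁ c₂ c₃ X Y Z) with hB0 | hBpos
  · rw [hB0, Nat.cast_zero]; positivity
  have hBr : (0 : ℝ) < shapeCount c₁ c₂ c₃ X Y Z := by exact_mod_cast hBpos
  -- `Λ = 2C₀`
  obtain ⟨Λ, hΛdef⟩ : ∃ Λ : ℝ, Λ = 2 * C₀ := ⟨_, rfl⟩
  have hΛ : 1 < Λ := by rw [hΛdef]; linarith
  have hΛ0 : 0 < Λ := by linarith
  have hlogΛ : 0 < Real.log Λ := Real.log_pos hΛ
  rcases le_or_gt (L / Real.log Λ) ρ with hlarge | hsmall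
  · -- LARGE SCALE: the record instance applies and its slack is `≤ 2ρ`
    -- `T = V₂ · 2C₀`, `Dτ = ⌊C_τ T^κ⌋`
    obtain ⟨T, hT⟩ : ∃ T : ℕ, T = V2 * (2 * C₀) := ⟨_, rfl⟩
    have hT1 : 1 ≤ T := by rw [hT]; exact Nat.mul_pos hV2pos (by omega)
    have hTpos : (0 : ℝ) < T := by exact_mod_cast hT1
    have hT' : (T : ℝ) = V2 * Λ := by rw [hT, hΛdef]; push_cast; ring
    have hTval : ∀ {c : ℕ} {W : Fin (J + e) → ℕ}, c * shapeVal W ≤ 2 * C₀ →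
        c * shapeVal (fun i => 2 * W i) ≤ T := by
      intro c W hW
      calc c * shapeVal (fun i => 2 * W i) = V2 * (c * shapeVal W) := by
            rw [show (fun i => 2 * W i) = fun i => (fun _ : Fin (J + e) => 2) i * W i from rfl,
              shapeVal_mul, ← hV2]; ring
        _ ≤ V2 * (2 * C₀) := Nat.mul_le_mul_left _ hW
        _ = T := hT.symm
    obtain ⟨Dτ, hDτ⟩ : ∃ D : ℕ, D = ⌊Cτ * (T : ℝ) ^ κ⌋₊ := ⟨_, rfl⟩
    have hD : ∀ n : ℕ, n ≠ 0 → n ≤ T → n.divisors.card ≤ Dτ := by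
      intro n hn hnT
      rw [hDτ]
      refine Nat.le_floor ((hCτ n hn).trans ?_)
      exact mul_le_mul_of_nonneg_left (Real.rpow_le_rpow (Nat.cast_nonneg _)
        (by exact_mod_cast hnT) hκ0.le) hCτ0.le
    have hDreal : (Dτ : ℝ) ≤ Cτ * (T : ℝ) ^ κ := by rw [hDτ]; exact Nat.floor_le (by positivity)
    have hD1 : 1 ≤ Dτ := by simpa using hD 1 one_ne_zero hT1
    have hDpos : (0 : ℝ) < Dτ := by exact_mod_cast hD1
    -- `P₀ = max(1, N₀, 2 log((M+2) T³)) ≤ P_c Λ^{ρ/2}`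
    obtain ⟨P₀, hP₀⟩ : ∃ P₀ : ℝ,
        P₀ = max 1 (max N₀ (2 * Real.log ((((J + e : ℕ) : ℝ) + 2) * (T : ℝ) ^ 3))) := ⟨_, rfl⟩
    have hP₀1 : 1 ≤ P₀ := by rw [hP₀]; exact le_max_left _ _
    have hP₀pos : 0 < P₀ := by linarith
    have hN₀P₀ : N₀ ≤ P₀ := by rw [hP₀]; exact (le_max_left _ _).trans (le_max_right _ _)
    have hlogP₀ : 2 * Real.log ((((J + e : ℕ) : ℝ) + 2) * (T : ℝ) ^ 3) ≤ P₀ := by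
      rw [hP₀]; exact (le_max_right _ _).trans (le_max_right _ _)
    have hΛρ : 1 ≤ Λ ^ (ρ / 2) := Real.one_le_rpow hΛ.le (by positivity)
    have hP₀le : P₀ ≤ Pc * Λ ^ (ρ / 2) := by
      have hPcΛ : Pc ≤ Pc * Λ ^ (ρ / 2) := le_mul_of_one_le_right hPc0.le hΛρ
      have h3 : Λ ^ (3 : ℝ) = Λ ^ (3 : ℕ) := by exact_mod_cast Real.rpow_natCast Λ 3
      have hx : (((J + e : ℕ) : ℝ) + 2) * (T : ℝ) ^ 3 = G * Λ ^ (3 : ℝ) := by rw [hG, hT', h3]; ring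
      have hlog : Real.log ((((J + e : ℕ) : ℝ) + 2) * (T : ℝ) ^ 3) ≤ (G ^ κ₂ / κ₂) * Λ ^ (ρ / 2) := by
        refine (Real.log_le_rpow_div (by positivity) hκ₂0).trans_eq ?_
        rw [hx, Real.mul_rpow hG0.le (by positivity), ← Real.rpow_mul hΛ0.le,
          show (3 : ℝ) * κ₂ = ρ / 2 by rw [hκ₂]; ring]
        ring
      rw [hP₀]
      refine max_le ((by linarith only [hPc1, hN₀] : (1 : ℝ) ≤ Pc).trans hPcΛ)
        (max_le ((by linarith only [hPc1] : N₀ ≤ Pc).trans hPcΛ) ?_)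
      calc 2 * Real.log ((((J + e : ℕ) : ℝ) + 2) * (T : ℝ) ^ 3) ≤ 2 * (G ^ κ₂ / κ₂) * Λ ^ (ρ / 2) := by
            linarith only [hlog]
        _ ≤ Pc * Λ ^ (ρ / 2) := by
            refine mul_le_mul_of_nonneg_right ?_ (by positivity)
            rw [hPc]; linarith only [hN₀]
    -- the determinant tool at every coordinate, for `P ≥ P₀`
    have hlogi : ∀ (i : Fin (J + e)) {P : ℝ}, P₀ ≤ P →
        2 * Real.log ((((i : ℕ) : ℝ) + 2) * (T : ℝ) ^ 3) ≤ P := by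
      intro i P hP
      have hiM : ((i : ℕ) : ℝ) + 2 ≤ ((J + e : ℕ) : ℝ) + 2 := by
        have : ((i : ℕ) : ℝ) ≤ ((J + e : ℕ) : ℝ) := by exact_mod_cast i.isLt.le
        linarith only [this]
      have hi : (((i : ℕ) : ℝ) + 2) * (T : ℝ) ^ 3 ≤ (((J + e : ℕ) : ℝ) + 2) * (T : ℝ) ^ 3 :=
        mul_le_mul_of_nonneg_right hiM (by positivity)
      have hll := Real.log_le_log (by positivity) hi
      linarith only [hll, hlogP₀, hP]
    -- the record instance on this datum
    have hrec := hR hc₁ hc₂ hc₃ hC₀1 hXp hYp hZp (hTval hvX) (hTval hvY) (hTval hvZ) hD hC₀le hvX hvY hvZ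
      hPle hBpos hP₀1
      (fun i hi P hP h48 => hdet hc₁ hc₂ hc₃ X Y Z hXp hYp hZp (hTval hvX) (hTval hvY) (hTval hvZ) hD
        i hi P (hN₀P₀.trans hP) (hlogi i hP) h48)
      @sqrtLatticeToolX @sqrtLatticeToolZ
    rw [← hΛdef] at hrec
    -- the slack: `σ ≤ L / log Λ + ρ ≤ 2ρ`
    have hlD : Real.logb Λ Dτ ≤ Real.logb Λ Cτ + κ * Real.logb Λ V2 + κ := by
      have h1 : Real.logb Λ Dτ ≤ Real.logb Λ (Cτ * (T : ℝ) ^ κ) := Real.logb_le_logb_of_le hΛ hDpos hDreal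
      rw [Real.logb_mul hCτ0.ne' (by positivity), Real.logb_rpow_eq_mul_logb_of_pos hTpos, hT',
        Real.logb_mul hV2r.ne' hΛ0.ne', Real.logb_self_eq_one hΛ] at h1
      linarith only [h1]
    have hlP : Real.logb Λ P₀ ≤ Real.logb Λ Pc + ρ / 2 := by
      have h1 : Real.logb Λ P₀ ≤ Real.logb Λ (Pc * Λ ^ (ρ / 2)) := Real.logb_le_logb_of_le hΛ hP₀pos hP₀le
      rwa [Real.logb_mul hPc0.ne' (by positivity), Real.logb_rpow hΛ0 hΛ.ne'] at h1
    have hLsum : a * Real.logb Λ Cτ + (ρ / 2 + 1) * Real.logb Λ V2 + ((J : ℝ) ^ 2 + J + 10) * Real.logb Λ 2 +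
        Real.logb Λ 27 + Real.logb Λ 48 + Real.logb Λ 114 + Real.logb Λ (24 * (J : ℝ) * ((J : ℝ) + 1)) +
        Real.logb Λ Pc = L / Real.log Λ := by
      rw [hL]; simp only [Real.logb]; ring
    have hlDa : a * Real.logb Λ Dτ ≤ a * Real.logb Λ Cτ + (ρ / 2) * Real.logb Λ V2 + ρ / 2 := by
      have h1 := mul_le_mul_of_nonneg_left hlD ha0.le
      have h2 : a * (Real.logb Λ Cτ + κ * Real.logb Λ V2 + κ) =
          a * Real.logb Λ Cτ + (a * κ) * Real.logb Λ V2 + a * κ := by ring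
      rw [h2, hκa] at h1
      exact h1
    have hσ : recordSlack J (J + e) Λ Dτ P₀ (l + 3 * ε) s₀ ≤ 2 * ρ := by
      have hmax : max (l + 3 * ε - s₀) 0 = 0 := max_eq_right (by linarith only [hl])
      rw [recordSlack, hmax, ← hV2, ← ha]
      linarith only [hlDa, hlP, hLsum, hlarge]
    have hσ1 : recordSlack J (J + e) Λ Dτ P₀ (l + 3 * ε) s₀ ≤ 1 / 1000 := by linarith only [hσ, hρ1]
    have hlogB : Real.logb Λ (shapeCount c₁ c₂ c₃ X Y Z) ≤ Vc + η := by
      linarith only [hrec hσ1, hσ, hρη, hη]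
    calc (shapeCount c₁ c₂ c₃ X Y Z : ℝ) = Λ ^ Real.logb Λ (shapeCount c₁ c₂ c₃ X Y Z) :=
          (Real.rpow_logb hΛ0 hΛ.ne' hBr).symm
      _ ≤ Λ ^ (Vc + η) := Real.rpow_le_rpow_of_exponent_le hΛ.le hlogB
      _ = (2 : ℝ) ^ (Vc + η) * (C₀ : ℝ) ^ (Vc + η) := by
          rw [hΛdef, Real.mul_rpow zero_le_two (by positivity)]
      _ ≤ K * (C₀ : ℝ) ^ (Vc + η) := mul_le_mul_of_nonneg_right hK2 (by positivity)
  · -- SMALL SCALE: `Λ < Λ₁`, trivial box bound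
    have h1 : ρ * Real.log Λ < L := (lt_div_iff₀ hlogΛ).mp hsmall
    have h2 : Real.log Λ < L / ρ := (lt_div_iff₀ hρ0).mpr (by linarith only [h1])
    have hΛlt : Λ < Λ₁ := by rw [hΛ₁]; exact (Real.log_lt_iff_lt_exp hΛ0).mp h2
    have hPleΛ : (∏ i, ((X i : ℝ) * Y i * Z i)) ≤ Λ ^ (l + 3 * ε) := by rw [hΛdef]; exact hPle
    calc (shapeCount c₁ c₂ c₃ X Y Z : ℝ) ≤ ∏ i, ((X i : ℝ) * Y i * Z i) := shapeCount_le_prod_box c₁ c₂ c₃ X Y Z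
      _ ≤ Λ ^ (l + 3 * ε) := hPleΛ
      _ ≤ Λ ^ (max (l + 3 * ε) 0) := Real.rpow_le_rpow_of_exponent_le hΛ.le (le_max_left _ _)
      _ ≤ Λ₁ ^ (max (l + 3 * ε) 0) := Real.rpow_le_rpow hΛ0.le hΛlt.le (le_max_right _ _)
      _ ≤ K := hKΛ
      _ ≤ K * (C₀ : ℝ) ^ (Vc + η) := le_mul_of_one_le_right hK0 hCpow

end Summit.ABC.ABC.Theorems.MazurKaneLaw

end
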